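import Literature.Topology.FourManifolds.ConnectedSumSphereIdentity
import Literature.Topology.FourManifolds.OrientedConnectedSumUniqueness
import HarnessLib

/-!
# `X # Sⁿ ≅ X` with comparison equations: the diffeomorphism is a FIXED map on the `X`-piece

Topic `Literature/Topology/FourManifolds`, sibling proofs file of `ConnectedSumSphereIdentity.lean`
(Kervaire–Milnor, *Groups of homotopy spheres I* (1963), §2: "`Sⁿ` serves as identity element";
Kosinski, *Differential Manifolds* (1993), VI.1.3). That file proves `Q ≅ X` for every manifold `Q`
glued from `X ∖ {i₁ 0}` and `Sⁿ ∖ {i₂ 0}` along Kervaire–Milnor's relation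
(`nonempty_diffeomorph_of_isConnectedSum_sphere'`), discarding the comparison equations of the
uniqueness of open gluings. This file records them (everything **proved**, no definition, no
named fact; D-0026):

* `ConnectedSumSphereData.isOpenGluing_connectedSumRel_explicit` — the standard model
  `X = (X ∖ {i₁ 0}) ∪ (S ∖ {-v})` with its EXPLICIT gluing embeddings `(↑) ∘ α` and `(↑) ∘ β`
  (`α = Φ⁻¹ ∘ h ∘ Φ` the transported puncture expansion, `β` the transported ball contraction);
* `ConnectedSumSphereData.explicit_of_diffeomorph_apply_eq` — the Palais reparametrisation step
  `isOpenGluing_of_diffeomorph_apply_eq` with explicit embeddings (the `X`-piece embedding is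
  unchanged);
* `ConnectedSumSphereData.exists_diffeomorph_apply_eq_coe_α` — **uniqueness with equations**:
  for explicit gluing embeddings `(jA, jB)` of `Q`, there is `e : Q ≅ X` with
  `e (jA a) = α a` for all `a : X ∖ {i₁ 0}`;
* `exists_apply_eq_of_isOpenGluing_connectedSumRel_sphere` — **the controlled sphere identity**:
  for every equidimensional disc `i₁ : ℝⁿ ↪ X` there is ONE open smooth embedding
  `k : X ∖ {i₁ 0} ↪ X`, equal to the identity off `i₁(B̄(0, 3/4))`, such that for EVERY disc
  `i₂ : ℝⁿ ↪ Sⁿ` and EVERY manifold `Q` glued from `X ∖ {i₁ 0}` and `Sⁿ ∖ {i₂ 0}` along the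
  relation for `(i₁, i₂)` by embeddings `(jA, jB)`, there is a diffeomorphism `e : Q ≅ X` with
  `e ∘ jA = k`. In words: the identification `X # Sⁿ ≅ X` can be chosen to be a fixed map — the
  identity away from the disc — on the `X`-summand, whatever the sphere-side disc and whatever the
  presentation. This is what orientation bookkeeping across two such identifications needs.

## References

* M. Kervaire, J. Milnor, *Groups of homotopy spheres I*, Ann. of Math. 77 (1963), §2 ("`Sⁿ`
  serves as identity element", Lemma 2.1). [cite: KervaireMilnor1963, §2]
* A. Kosinski, *Differential Manifolds* (1993), Ch. VI §1, proof of Thm. (1.1) (the comparison map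
  of two gluings), (1.3). [cite: Kosinski1993, Ch. VI §1]
* R. Palais, *Extending diffeomorphisms*, Proc. AMS 11 (1960), Thm. B. [cite: Palais1960, Thm. B]
-/

open scoped Manifold ContDiff Topology
open Set Function Metric Module

noncomputable section

universe u

namespace Literature.Topology.FourManifolds

namespace ConnectedSumSphereData

variable {V : Type*} [NormedAddCommGroup V] [InnerProductSpace ℝ V] {n : ℕ}
  [Fact (finrank ℝ V = n + 1)] {X : Type*} [TopologicalSpace X] [T2Space X]
  [ChartedSpace (EuclideanSpace ℝ (Fin n)) X] [IsManifold (𝓡 n) ∞ X]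
  (D : ConnectedSumSphereData V n X)

/-- **The standard model with explicit embeddings.** `X` is glued from `X ∖ {i₁ 0}` and
`S ∖ {i₂ 0}` along Kervaire–Milnor's relation for `(i₁, i₂)` by the EXPLICIT embeddings
`(↑) ∘ α : X ∖ {i₁ 0} ≅ X ∖ i₁(B̄(0, 1/8)) ⊆ X` and `(↑) ∘ β : S ∖ {-v} ≅ i₁(B(0, 1)) ⊆ X` (the
witnesses behind `isOpenGluing_connectedSumRel`). [cite: KervaireMilnor1963, §2] -/
theorem isOpenGluing_connectedSumRel_explicit :
    Manifold.IsSmoothEmbedding (𝓡 n) (𝓡 n) ∞ (Subtype.val ∘ D.α) ∧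
      IsOpen (range (Subtype.val ∘ D.α)) ∧
      Manifold.IsSmoothEmbedding (𝓡 n) (𝓡 n) ∞ (Subtype.val ∘ D.β) ∧
      IsOpen (range (Subtype.val ∘ D.β)) ∧
      range (Subtype.val ∘ D.α) ∪ range (Subtype.val ∘ D.β) = univ ∧
      ∀ a b, (Subtype.val ∘ D.α) a = (Subtype.val ∘ D.β) b ↔ connectedSumRel D.i₁ D.i₂ a b := by
  have hαs : Function.Surjective (D.α : ↥(puncture D.i₁) → ↥D.Uα) := D.α.surjective
  have hβs : Function.Surjective (D.β : ↥(puncture D.i₂) → ↥D.Uβ) := D.β.surjective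
  have hrα : range (Subtype.val ∘ D.α) = (D.Uα : Set X) := by
    rw [range_comp, hαs.range_eq, image_univ, Subtype.range_coe_subtype]
    rfl
  have hrβ : range (Subtype.val ∘ D.β) = (D.Uβ : Set X) := by
    rw [range_comp, hβs.range_eq, image_univ, Subtype.range_coe_subtype]
    rfl
  refine ⟨(Manifold.IsSmoothEmbedding.of_opens D.Uα).comp_diffeomorph D.α, ?_,
    (Manifold.IsSmoothEmbedding.of_opens D.Uβ).comp_diffeomorph D.β, ?_, ?_,
    fun a b => D.α_eq_β_iff a b⟩
  · rw [hrα]; exact D.Uα.isOpen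
  · rw [hrβ]; exact D.Uβ.isOpen
  · rw [hrα, hrβ]; exact D.Uα_union_Uβ

omit [IsManifold (𝓡 n) ∞ X] in
/-- **Palais reparametrisation, explicit form.** If `(jA, jB)` glue `Q` from `X ∖ {i₁ 0}` and
`S ∖ {i₂' 0}` along the relation for `(i₁, i₂')`, and the diffeomorphism `Ψ` of the sphere
satisfies `Ψ (i₂ y) = i₂' y` for `‖y‖ ≤ 1` (`i₂` the round disc), then `(jA, jB ∘ Ψ|)` glue `Q`
from `X ∖ {i₁ 0}` and `S ∖ {i₂ 0}` along the relation for `(i₁, i₂)` — the `X`-piece embedding is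
unchanged (the witnesses behind `isOpenGluing_of_diffeomorph_apply_eq`).
[cite: KervaireMilnor1963, §2] -/
theorem explicit_of_diffeomorph_apply_eq {Q : Type*} [TopologicalSpace Q]
    [ChartedSpace (EuclideanSpace ℝ (Fin n)) Q] {i₂' : EuclideanSpace ℝ (Fin n) → sphere (0 : V) 1}
    (Ψ : (sphere (0 : V) 1) ≃ₘ⟮𝓡 n, 𝓡 n⟯ (sphere (0 : V) 1))
    (hΨ : ∀ y : EuclideanSpace ℝ (Fin n), ‖y‖ ≤ 1 → Ψ (D.i₂ y) = i₂' y)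
    {jA : ↥(puncture D.i₁) → Q} {jB : ↥(puncture i₂') → Q}
    (hA : Manifold.IsSmoothEmbedding (𝓡 n) (𝓡 n) ∞ jA) (hAo : IsOpen (range jA))
    (hB : Manifold.IsSmoothEmbedding (𝓡 n) (𝓡 n) ∞ jB) (hBo : IsOpen (range jB))
    (hU : range jA ∪ range jB = univ)
    (hR : ∀ a b, jA a = jB b ↔ connectedSumRel D.i₁ i₂' a b) :
    ∃ ψB : ↥(puncture D.i₂) ≃ₘ⟮𝓡 n, 𝓡 n⟯ ↥(puncture i₂'),
      (∀ b, ((ψB b : ↥(puncture i₂')) : sphere (0 : V) 1) = Ψ b) ∧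
      Manifold.IsSmoothEmbedding (𝓡 n) (𝓡 n) ∞ jA ∧ IsOpen (range jA) ∧
      Manifold.IsSmoothEmbedding (𝓡 n) (𝓡 n) ∞ (jB ∘ ψB) ∧ IsOpen (range (jB ∘ ψB)) ∧
      range jA ∪ range (jB ∘ ψB) = univ ∧
      ∀ a b, jA a = (jB ∘ ψB) b ↔ connectedSumRel D.i₁ D.i₂ a b := by
  have h0 : Ψ (D.i₂ 0) = i₂' 0 := hΨ 0 (by simp)
  have hmem : ∀ b : sphere (0 : V) 1, b ∈ puncture D.i₂ ↔ Ψ b ∈ puncture i₂' := fun b => by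
    rw [mem_puncture, mem_puncture, ← h0]
    exact ⟨fun h h' => h (Ψ.injective h'), fun h h' => h (congrArg Ψ h')⟩
  set ψB := opensCongr Ψ (puncture D.i₂) (puncture i₂') hmem with hψB
  have hψs : Function.Surjective (ψB : ↥(puncture D.i₂) → ↥(puncture i₂')) := ψB.surjective
  have hn1 : ∀ (u : EuclideanSpace ℝ (Fin n)) (t : ℝ), ‖u‖ = 1 → t ∈ Ioo (0 : ℝ) 1 →
      ‖(1 - t) • u‖ ≤ 1 := fun u t hu ht => by
    rw [norm_smul, hu, mul_one, Real.norm_of_nonneg (by linarith [ht.2])]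
    linarith [ht.1]
  refine ⟨ψB, fun b => rfl, hA, hAo, hB.comp_diffeomorph ψB, ?_, ?_, fun a b => ?_⟩
  · rwa [hψs.range_comp]
  · rwa [hψs.range_comp]
  · rw [comp_apply, hR]
    constructor
    · rintro ⟨u, t, hu, ht, ha, hb⟩
      have h1 : Ψ b = Ψ (D.i₂ ((1 - t) • u)) := by
        rw [hΨ _ (hn1 u t hu ht), ← hb, hψB, coe_opensCongr_apply]
      exact ⟨u, t, hu, ht, ha, Ψ.injective h1⟩
    · rintro ⟨u, t, hu, ht, ha, hb⟩
      refine ⟨u, t, hu, ht, ha, ?_⟩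
      rw [← hΨ _ (hn1 u t hu ht), ← hb, hψB, coe_opensCongr_apply]

/-- **`X # Sⁿ ≅ X`, uniqueness step with comparison equations.** If `(jA, jB)` glue `Q` from
`X ∖ {i₁ 0}` and `S ∖ {i₂' 0}` along Kervaire–Milnor's relation, where `i₁ = Φ⁻¹` and `i₂'`
agrees on the closed unit disc with `Ψ ∘ i₂`, `i₂ = σᵥ⁻¹ ∘ S₀` round, then there is a
diffeomorphism `e : Q ≅ X` WITH `e (jA a) = α a` for every `a : X ∖ {i₁ 0}`: the comparison map of
the two gluings (Kosinski VI §1, proof of Thm. (1.1); `IsOpenGluing.exists_diffeomorph_comp_eq`)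
against the explicit standard model. [cite: Kosinski1993, Ch. VI §1] [cite: KervaireMilnor1963, §2] -/
theorem exists_diffeomorph_apply_eq_coe_α {Q : Type*} [TopologicalSpace Q]
    [ChartedSpace (EuclideanSpace ℝ (Fin n)) Q] [IsManifold (𝓡 n) ∞ Q]
    {i₂' : EuclideanSpace ℝ (Fin n) → sphere (0 : V) 1}
    (Ψ : (sphere (0 : V) 1) ≃ₘ⟮𝓡 n, 𝓡 n⟯ (sphere (0 : V) 1))
    (hΨ : ∀ y : EuclideanSpace ℝ (Fin n), ‖y‖ ≤ 1 → Ψ (D.i₂ y) = i₂' y)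
    {jA : ↥(puncture D.i₁) → Q} {jB : ↥(puncture i₂') → Q}
    (hA : Manifold.IsSmoothEmbedding (𝓡 n) (𝓡 n) ∞ jA) (hAo : IsOpen (range jA))
    (hB : Manifold.IsSmoothEmbedding (𝓡 n) (𝓡 n) ∞ jB) (hBo : IsOpen (range jB))
    (hU : range jA ∪ range jB = univ)
    (hR : ∀ a b, jA a = jB b ↔ connectedSumRel D.i₁ i₂' a b) :
    ∃ e : Q ≃ₘ⟮𝓡 n, 𝓡 n⟯ X, ∀ a : ↥(puncture D.i₁), e (jA a) = (D.α a : X) := by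
  obtain ⟨ψB, -, h1, h2, h3, h4, h5, h6⟩ :=
    D.explicit_of_diffeomorph_apply_eq Ψ hΨ hA hAo hB hBo hU hR
  obtain ⟨k1, k2, k3, k4, k5, k6⟩ := D.isOpenGluing_connectedSumRel_explicit
  obtain ⟨e, he, -⟩ := IsOpenGluing.exists_diffeomorph_comp_eq h1 h2 h3 h4 h5 h6 k1 k2 k3 k4 k5 k6
  exact ⟨e, he⟩

end ConnectedSumSphereData

/-! ### The controlled sphere identity -/

/-- **`X # Sⁿ ≅ X` by a FIXED map on the `X`-summand.** Let `i₁ : ℝⁿ ↪ X` be a smooth embedding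
of the model space into the smooth `n`-manifold `X` (Hausdorff; a disc). There is an open smooth
embedding `k : X ∖ {i₁ 0} ↪ X`, equal to the identity off `i₁(B̄(0, 3/4))` (it is the puncture
expansion transported along the chart `i₁⁻¹`), with the following property: for EVERY smooth
embedding `i₂ : ℝⁿ ↪ Sⁿ` into the unit sphere of an `(n+1)`-dimensional inner product space and
EVERY manifold `Q` glued from `X ∖ {i₁ 0}` and `Sⁿ ∖ {i₂ 0}` along Kervaire–Milnor's relation for
`(i₁, i₂)` by open smooth embeddings `(jA, jB)`, there is a diffeomorphism `e : Q ≅ X` with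
`e (jA a) = k a` for all `a`. Proof: `k = (↑) ∘ α` for the standard-model data with chart
`Φ = i₁⁻¹` (`exists_chart_of_isSmoothEmbedding`) — `α` depends on `Φ` only, not on the pole or
the isometry of the round disc —; for each `i₂`, Palais' disc theorem in the sphere
(`exists_diffeomorph_apply_stereographic_symm_eq`) supplies `Ψ`, `B` with
`Ψ ∘ σᵥ⁻¹ ∘ B⁻¹ = i₂` on the unit disc, and `ConnectedSumSphereData.exists_diffeomorph_apply_eq_coe_α`
the diffeomorphism with its equation. Kervaire–Milnor 1963, §2 ("`Sⁿ` serves as identity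
element"); Kosinski 1993, VI.1.3 and proof of Thm. (1.1); Palais 1960, Thm. B.
[cite: KervaireMilnor1963, §2] [cite: Kosinski1993, Ch. VI §1] [cite: Palais1960, Thm. B] -/
theorem exists_apply_eq_of_isOpenGluing_connectedSumRel_sphere {n : ℕ} {X : Type*}
    [TopologicalSpace X] [T2Space X] [ChartedSpace (EuclideanSpace ℝ (Fin n)) X]
    [IsManifold (𝓡 n) ∞ X] {i₁ : EuclideanSpace ℝ (Fin n) → X}
    (h₁ : Manifold.IsSmoothEmbedding (𝓡 n) (𝓡 n) ∞ i₁) :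
    ∃ k : ↥(puncture i₁) → X,
      Manifold.IsSmoothEmbedding (𝓡 n) (𝓡 n) ∞ k ∧ IsOpen (range k) ∧
      (∀ a : ↥(puncture i₁), (a : X) ∉ i₁ '' closedBall 0 (3 / 4) → k a = a) ∧
      ∀ {V : Type u} [NormedAddCommGroup V] [InnerProductSpace ℝ V] [Fact (finrank ℝ V = n + 1)]
        {i₂ : EuclideanSpace ℝ (Fin n) → sphere (0 : V) 1}
        (_h₂ : Manifold.IsSmoothEmbedding (𝓡 n) (𝓡 n) ∞ i₂)
        {Q : Type u} [TopologicalSpace Q] [ChartedSpace (EuclideanSpace ℝ (Fin n)) Q]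
        [IsManifold (𝓡 n) ∞ Q] {jA : ↥(puncture i₁) → Q} {jB : ↥(puncture i₂) → Q}
        (_hA : Manifold.IsSmoothEmbedding (𝓡 n) (𝓡 n) ∞ jA) (_hAo : IsOpen (range jA))
        (_hB : Manifold.IsSmoothEmbedding (𝓡 n) (𝓡 n) ∞ jB) (_hBo : IsOpen (range jB))
        (_hU : range jA ∪ range jB = univ)
        (_hR : ∀ a b, jA a = jB b ↔ connectedSumRel i₁ i₂ a b),
        ∃ e : Q ≃ₘ⟮𝓡 n, 𝓡 n⟯ X, ∀ a : ↥(puncture i₁), e (jA a) = k a := by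
  obtain ⟨Φ, hΦt, hΦe, -, hΦc⟩ := exists_chart_of_isSmoothEmbedding h₁
  subst hΦe
  have hsymm : ContMDiff (𝓡 n) (𝓡 n) ∞ Φ.symm := h₁.contMDiff
  -- the fixed map `k = Φ⁻¹ ∘ h ∘ Φ` on `X ∖ {i₁ 0}`
  refine ⟨fun a => chartTransport Φ punctureExpansion (a : X), ?_, ?_, fun a ha => ?_, ?_⟩
  · -- a smooth embedding: it is `(↑) ∘ α` for any standard-model data with chart `Φ`
    haveI : Fact (finrank ℝ (EuclideanSpace ℝ (Fin (n + 1))) = n + 1) :=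
      ⟨finrank_euclideanSpace_fin⟩
    obtain ⟨p⟩ : Nonempty (sphere (0 : EuclideanSpace ℝ (Fin (n + 1))) 1) :=
      (NormedSpace.sphere_nonempty.mpr zero_le_one).to_subtype
    set D₀ : ConnectedSumSphereData (EuclideanSpace ℝ (Fin (n + 1))) n X :=
      ⟨Φ, hΦt, hΦc, hsymm, p, LinearIsometryEquiv.refl ℝ _⟩
    exact D₀.isOpenGluing_connectedSumRel_explicit.1
  · haveI : Fact (finrank ℝ (EuclideanSpace ℝ (Fin (n + 1))) = n + 1) :=
      ⟨finrank_euclideanSpace_fin⟩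
    obtain ⟨p⟩ : Nonempty (sphere (0 : EuclideanSpace ℝ (Fin (n + 1))) 1) :=
      (NormedSpace.sphere_nonempty.mpr zero_le_one).to_subtype
    set D₀ : ConnectedSumSphereData (EuclideanSpace ℝ (Fin (n + 1))) n X :=
      ⟨Φ, hΦt, hΦc, hsymm, p, LinearIsometryEquiv.refl ℝ _⟩
    exact D₀.isOpenGluing_connectedSumRel_explicit.2.1
  · exact chartTransport_eq_self (fun y hy => punctureExpansion_eq_self hy) ha
  · intro V _ _ _ i₂ h₂ Q _ _ _ jA jB hA hAo hB hBo hU hR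
    obtain ⟨Ψ, B, hΨ⟩ := exists_diffeomorph_apply_stereographic_symm_eq h₂
    set D : ConnectedSumSphereData V n X := ⟨Φ, hΦt, hΦc, hsymm, -i₂ 0, B.symm⟩ with hD
    have hΨ' : ∀ y : EuclideanSpace ℝ (Fin n), ‖y‖ ≤ 1 → Ψ (D.i₂ y) = i₂ y := fun y hy => by
      have h := hΨ (B.symm y) (by rwa [LinearIsometryEquiv.norm_map])
      rwa [LinearIsometryEquiv.apply_symm_apply] at h
    obtain ⟨e, he⟩ := D.exists_diffeomorph_apply_eq_coe_α Ψ hΨ' hA hAo hB hBo hU hR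
    exact ⟨e, fun a => (he a).trans (D.coe_α a)⟩

end Literature.Topology.FourManifolds

end
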